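import Summits.ResolutionOfSingularities.ResolutionOfSingularities.Theorems.FrobeniusClosingSteerLowTowerPointChart
import Summits.ResolutionOfSingularities.ResolutionOfSingularities.Theorems.FrobeniusClosingSteerLowTowerStages
import Summits.ResolutionOfSingularities.ResolutionOfSingularities.Theorems.FrobeniusClosingSteerLowTowerResidueTrdeg
import HarnessLib

/-!
# D3a part 9: the steps of a threaded run read on the critical surface, in the shapes of the threading contract
(res-D-pv-012 AS res-L0-w41-stub-8; W4.1 crux `Steer`, LOW branch, strat-2 §σ2.24; consumes res-L0-w41-stub-3's `hthread` step shapes and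
res-type-026's `trdeg_eq_two_of_surfaceGerm`.) OURS; AI.

* `pointStep_images` — the point-step shape of `hthread` (`R' = (R[𝔪/x])_{𝔪_O}`, `y/x ∈ O` for non-units `y`, `φ(x) ≠ 0`) gives the
  chart data of clause (T6) for ANY subrings `S = φ(R)`, `S' = φ(R')` of `L` and any local-ring structure on `S` (kernel hygiene: the
  images are kept abstract with defining equations).
* `curveStep_images` — the curve-step shape (`R' = (R[S₀])_{𝔪_O}` for a finite `S₀ ⊆ O` of elements congruent to members of `R` modulo
  the non-units of `Λ`) gives `φ(R') = φ(R)` (clause (T7): `A (n+1) = A n`).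
* `trdeg_eq_two_of_critical` — clause (T0): `trdeg_k L = 2` for an algebraic extension `L` of the residue field `κ(𝔮)` of
  `Λ = (R i₀)_𝔮`, from the invariant at stage `i₀` and the model `R i₀ = (B)_{𝔪_O ∩ B}`.
-/

noncomputable section
set_option linter.dupNamespace false

namespace Summit.ResolutionOfSingularities.ResolutionOfSingularities.Theorems.SwitchingDichotomy.LowTower

open IsLocalRing Polynomial
open Literature.AlgebraicGeometry.Resolution

variable {K L : Type} [Field K] [Field L]

/-- **(T6) data from the point-step shape of the threading contract.** [cite: Cutkosky2014, §2.1] [folklore] -/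
theorem pointStep_images (Λ : Subring K) (φ : Λ →+* L) (hker : ∀ r : Λ, φ r = 0 → ¬ IsUnit r)
    (O : ValuationSubring K) (R R' : Subring K) [IsLocalRing R] (hR : R ≤ Λ) (hR'Λ : R' ≤ Λ) (hRO : R ≤ O.toSubring)
    (x : K) (hxR : x ∈ R) (hxnu : ¬ IsUnit (⟨x, hxR⟩ : R)) (hx0 : x ≠ 0)
    (hdiv : ∀ y (hy : y ∈ R), ¬ IsUnit (⟨y, hy⟩ : R) → y / x ∈ O)
    (he : R' = locAtCentre (blowupRing R x) O) (hdom : SubringDominates R R') (hφx : φ ⟨x, hR hxR⟩ ≠ 0)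
    (S S' : Subring L) (hS : S = (R.comap Λ.subtype).map φ) (hS' : S' = (R'.comap Λ.subtype).map φ) (inst : IsLocalRing S) :
    @blowupRing L _ S inst (φ ⟨x, hR hxR⟩) ≤ S' ∧
      (∀ z ∈ S', ∃ a ∈ @blowupRing L _ S inst (φ ⟨x, hR hxR⟩), ∃ b ∈ @blowupRing L _ S inst (φ ⟨x, hR hxR⟩),
        b⁻¹ ∈ S' ∧ z = a / b) ∧
      SubringDominates S S' := by
  have hxm : (⟨x, hxR⟩ : R) ∈ maximalIdeal R := (mem_maximalIdeal _).mpr (mem_nonunits_iff.mpr hxnu)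
  have hdiv' : ∀ y : R, y ∈ maximalIdeal R → (y : K) / x ∈ O := fun y hy =>
    hdiv y y.2 (by simpa using mem_nonunits_iff.mp ((mem_maximalIdeal _).mp hy))
  have hR'le : locAtCentre (blowupRing R x) O ≤ Λ := by rw [← he]; exact hR'Λ
  have hdom' : SubringDominates R (locAtCentre (blowupRing R x) O) := by rw [← he]; exact hdom
  haveI : IsLocalRing ((R.comap Λ.subtype).map φ) := isLocalRing_map Λ φ R hR
  have hdata := map_quadraticTransform_data Λ φ hker O R hR hRO x hxR hxm hx0 hdiv' hφx hR'le hdom'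
  subst hS
  rw [he] at hS'
  subst hS'
  exact hdata

/-- **(T7) from the curve-step shape of the threading contract: the surface germ does not move.** [folklore] -/
theorem curveStep_images (Λ : Subring K) (φ : Λ →+* L) (hker : ∀ r : Λ, φ r = 0 ↔ ¬ IsUnit r)
    (O : ValuationSubring K) (R R' : Subring K) [IsLocalRing R] (hR : R ≤ Λ) (hR'Λ : R' ≤ Λ) (hRO : R ≤ O.toSubring)
    (S₀ : Finset K) (hSO : (↑S₀ : Set K) ⊆ ↑O)
    (hSr : ∀ z ∈ S₀, ∃ r ∈ R, ∃ hzr : z - r ∈ Λ, ¬ IsUnit (⟨z - r, hzr⟩ : Λ))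
    (he : R' = locAtCentre (Subring.closure ((R : Set K) ∪ ↑S₀)) O) (hdom : SubringDominates R R') :
    (R'.comap Λ.subtype).map φ = (R.comap Λ.subtype).map φ := by
  have hSΛ : (↑S₀ : Set K) ⊆ Λ := fun z hz => by
    obtain ⟨r, hr, hzr, -⟩ := hSr z hz
    have : z = (z - r) + r := by ring
    rw [this]; exact Λ.add_mem hzr (hR hr)
  have hSR : ∀ z (hz : z ∈ (↑S₀ : Set K)), φ ⟨z, hSΛ hz⟩ ∈ (R.comap Λ.subtype).map φ := by
    intro z hz
    obtain ⟨r, hr, hzr, hnu⟩ := hSr z hz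
    have hsplit : φ ⟨z, hSΛ hz⟩ = φ ⟨z - r, hzr⟩ + φ ⟨r, hR hr⟩ := by
      rw [← map_add]; congr 1; exact Subtype.ext (by simp)
    rw [hsplit, (hker _).mpr hnu, zero_add]
    exact (mem_map_comap_iff Λ φ _ _).mpr ⟨_, hr, rfl⟩
  have hR'le : locAtCentre (Subring.closure ((R : Set K) ∪ ↑S₀)) O ≤ Λ := by rw [← he]; exact hR'Λ
  have hdom' : SubringDominates R (locAtCentre (Subring.closure ((R : Set K) ∪ ↑S₀)) O) := by rw [← he]; exact hdom
  rw [he]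
  exact map_locAtCentre_closure_eq Λ φ (fun r => (hker r).mp) O R hR hRO _ hSΛ hSO hSR hR'le hdom'

/-- **(T0) `trdeg_k L = 2`** for `L` algebraic over the residue field `κ(𝔮)` of `Λ = (R i₀)_𝔮` inside `K`: the surface germ
`φ(R i₀) ⊆ κ(𝔮)` is a `k`-subalgebra with fraction field `κ(𝔮)`, local, essentially of finite type (`R i₀ = (B)_{𝔪_O ∩ B}`), of dimension
`2` (the invariant at `i₀`), with `k`-algebraic residue field (`ZeroDim k O`), so res-type-026's `trdeg_eq_two_of_surfaceGerm` applies.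
[cite: Matsumura1987, Thm. 5.6] [folklore] -/
theorem trdeg_eq_two_of_critical {k : Type} [Field k] [Algebra k K] (O : ValuationSubring K)
    (hzd : ∀ x ∈ O, ∃ f : Polynomial k, f ≠ 0 ∧ Polynomial.aeval x f ∈ O.nonunits)
    (R : Subring K) [IsLocalRing R] (B : Subalgebra k K) (hB : B.FG) (hBO : B.toSubring ≤ O.toSubring)
    (hRB : R = locAtCentre B.toSubring O) (hdim : ringKrullDim R = (4 : ℕ))
    (𝔮 : Ideal R) [𝔮.IsPrime] (Λ : Subring K) [IsLocalRing Λ] (h1 : R ≤ Λ)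
    (h2 : ∀ r (hr : r ∈ R), (⟨r, hr⟩ : R) ∉ 𝔮 → r⁻¹ ∈ Λ)
    (h4 : ∀ z ∈ Λ, ∃ a u : K, ∃ (_ : a ∈ R) (hu : u ∈ R), (⟨u, hu⟩ : R) ∉ 𝔮 ∧ z = a / u)
    (e₁ e₂ : R) (htrace : ∀ r : R, r ∈ Ideal.span {e₁, e₂} ↔ ¬ IsUnit (⟨(r : K), h1 r.2⟩ : Λ)) (hrsop : IsRsopPart ![e₁, e₂])
    [Algebra k (ResidueField Λ)]
    (hφk : ∀ c : k, ∃ hc : algebraMap k K c ∈ Λ, residue Λ ⟨algebraMap k K c, hc⟩ = algebraMap k (ResidueField Λ) c)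
    (L : Type) [Field L] [Algebra (ResidueField Λ) L] [Algebra k L] [IsScalarTower k (ResidueField Λ) L]
    [Algebra.IsAlgebraic (ResidueField Λ) L] : Algebra.trdeg k L = 2 := by
  have hRO : R ≤ O.toSubring := by rw [hRB]; exact locAtCentre_le hBO
  have hkR : ∀ c : k, algebraMap k K c ∈ R := fun c => by rw [hRB]; exact le_locAtCentre _ O (B.algebraMap_mem c)
  have hkΛ : ∀ c : k, algebraMap k K c ∈ Λ := fun c => h1 (hkR c)
  have hφk' : ∀ c : k, residue Λ ⟨algebraMap k K c, hkΛ c⟩ = algebraMap k (ResidueField Λ) c := fun c => by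
    obtain ⟨hc, h⟩ := hφk c; exact h
  have hkerφ : ∀ r : Λ, residue Λ r = 0 ↔ ¬ IsUnit r := fun r => by
    rw [residue_eq_zero_iff, mem_maximalIdeal, mem_nonunits_iff]
  obtain ⟨A₀, hA₀⟩ := exists_subalgebra_toSubring_eq_map Λ (residue Λ) hkΛ hφk' R hkR
  have hreg₀ := isRegularLocalRing_map_of_inv Λ (residue Λ) hkerφ R h1 hdim e₁ e₂ htrace hrsop
  have hfr₀ := isFractionRing_map_residue R Λ 𝔮 h1 h2 h4
  haveI : IsFractionRing A₀ (ResidueField Λ) := by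
    have key : ∀ (S : Subring (ResidueField Λ)) (hS : S = (R.comap Λ.subtype).map (residue Λ)),
        IsFractionRing S (ResidueField Λ) := by intro S hS; subst hS; exact hfr₀
    exact key A₀.toSubring hA₀
  haveI : IsLocalRing A₀ := by
    have key : ∀ (S : Subring (ResidueField Λ)) (hS : S = (R.comap Λ.subtype).map (residue Λ)), IsLocalRing S := by
      intro S hS; subst hS; exact isLocalRing_map Λ (residue Λ) _ h1
    exact key A₀.toSubring hA₀
  haveI : Algebra.EssFiniteType k A₀ :=
    essFiniteType_of_toSubring_eq_map_locAtCentre Λ (residue Λ) hkΛ hφk' O B hB hBO (by rw [← hRB]; exact h1) A₀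
      (by rw [hA₀, ← hRB])
  have hdim₀ : ringKrullDim A₀ = (2 : ℕ) := by
    show ringKrullDim A₀.toSubring = _
    rw [hA₀]; exact hreg₀.2
  have hzd₀ := exists_aeval_not_isUnit Λ (residue Λ) hkΛ hφk' O hzd R h1 hRO hkR A₀ hA₀
  exact trdeg_eq_two_of_surfaceGerm k (ResidueField Λ) L A₀ hdim₀ hzd₀

end Summit.ResolutionOfSingularities.ResolutionOfSingularities.Theorems.SwitchingDichotomy.LowTower

end
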